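import Literature.Topology.FourManifolds.WhiteheadExtendG
import HarnessLib

/-!
# Whitehead triangulations, the extension step (Munkres 10.4), part X4b: the extended map `F₃`

Continuation of `WhiteheadExtendG`.  On the glued complex `G₃ ⊆ V₃` we define the extended map
`F₃ : V₃ → M`: on the old part (`Gold`, lifts of unchanged simplices) it is the bent map `f'` of
the first coordinate, on the new part (`Gnew`, translated simplices of `H`) it is `e.symm ∘ hmap`,
where `hmap` is the simplexwise affine map sending a translated vertex back to its chart point
(`PLMap.plMap` of the vertex values `gval`).  We prove: the two descriptions agree on the overlap
(`F₃_eq_of_mem_Gnew`), `F₃` is injective on `G₃.space` (`injOn_F₃`) and continuous on every closed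
face, its image is `f' '' K''.space ∪ e.symm '' R₀`, the chart descriptions of `F₃` on old and new
faces, and straightness of the faces whose image meets `e.symm '' (open outer box)`.

No named facts are introduced.
-/

open Set Function Metric Filter
open scoped Topology NNReal Manifold

noncomputable section

-- `[T2Space M]` is a section variable used by most lemmas below; per-lemma `omit` would be noise.
set_option linter.unusedSectionVars false

namespace Literature.Topology.FourManifolds

open Literature.Analysis.Convexity Literature.Analysis.Convexity.SignArrangement

local notation "𝔼 " n:arg => EuclideanSpace ℝ (Fin n)

namespace BendInput

variable {n N : ℕ} {M : Type*} [TopologicalSpace M] [T2Space M] {I : BendInput n N M}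

namespace BendSetup

variable (S : BendSetup I)

/-! ### Vertex values and kept straight simplices -/

/-- The chart value of a point of `V₃`: `(w, z, r) ↦ z + r • Λ (r⁻¹ • w)`; on translated vertices
it recovers the chart point. [folklore] -/
def gval (x : V₃ n N) : 𝔼 n := x.2.1 + x.2.2 • S.Λ (x.2.2⁻¹ • x.1)

/-- Auxiliary (`gval_oldV`). [folklore] -/
theorem gval_oldV (v : Fin N → ℝ) : S.gval (oldV v) = S.Λ v := by
  simp [gval, oldV]

/-- Auxiliary (`gval_newV`). [folklore] -/
theorem gval_newV (z : 𝔼 n) : S.gval (newV z) = z := by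
  simp [gval, newV]

/-- `gval ∘ psi = id`. [folklore] -/
theorem gval_psi (p : 𝔼 n) : S.gval (S.psi p) = p := by
  rcases S.psi_cases p with ⟨v, -, rfl, h⟩ | ⟨-, h⟩
  · rw [h, gval_oldV]
  · rw [h, gval_newV]

/-- The translation of the image of a straight simplex is its lift. [folklore] -/
theorem newFace_rIm {σ : Finset (Fin N → ℝ)} (hσ : σ ∈ S.Str) : S.newFace (S.rIm σ) = S.oldFace σ := by
  classical
  unfold newFace rIm oldFace
  rw [Finset.image_image]
  exact Finset.image_congr fun v hv => S.psi_Λ ⟨σ, hσ, Finset.mem_coe.1 hv⟩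

variable {S} (X : ExtInput S)

namespace ExtInput

/-- **Kept straight simplices**: a straight unchanged simplex has image in `Kept Q K₁h`. [folklore] -/
theorem rIm_mem_kept {σ : Finset (Fin N → ℝ)} (hσs : σ ∈ S.Str) (hσU : σ ∈ X.U) : S.rIm σ ∈ Kept S.Q X.K₁h := by
  classical
  refine ⟨S.rIm_mem_Q hσs, ?_, ?_⟩
  · rintro ⟨t, ht, σ', hσ't, hne, heq⟩
    have hσ' : σ' ∈ S.Str := X.str_of_subset_T₁ ht hσ't hne
    have hss : σ' = σ := S.image_Λ_injOn hσ' hσs (by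
      show σ'.image S.Λ = σ.image S.Λ
      have h1 : S.rIm σ' = S.rIm σ := heq
      unfold BendSetup.rIm at h1
      convert h1 using 2)
    subst hss
    obtain ⟨v, hv⟩ := hne
    exact Finset.disjoint_left.1 (hσU.2 t ht) hv (hσ't hv)
  · rintro _ ⟨t, ht, σ', hσ't, hne, rfl⟩
    rw [Finset.eq_empty_iff_forall_notMem]
    intro p hp
    rw [Finset.mem_inter] at hp
    obtain ⟨hp1, hp2⟩ := hp
    unfold BendSetup.rIm at hp1 hp2
    obtain ⟨v, hv, rfl⟩ := Finset.mem_image.1 hp1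
    obtain ⟨v', hv', hvv'⟩ := Finset.mem_image.1 hp2
    have hσ' : σ' ∈ S.Str := X.str_of_subset_T₁ ht hσ't hne
    have : v' = v := S.injOn_Λ_strVert ⟨σ', hσ', hv'⟩ ⟨σ, hσs, hv⟩ hvv'
    subst this
    exact Finset.disjoint_left.1 (hσU.2 t ht) hv (hσ't hv')

/-- Kept straight simplices are simplices of `H` (through their images). [folklore] -/
theorem rIm_mem_H {σ : Finset (Fin N → ℝ)} (hσs : σ ∈ S.Str) (hσU : σ ∈ X.U) : S.rIm σ ∈ X.H.faces :=
  X.mem_H_faces.2 (Or.inl (X.kept_subset_K' (X.rIm_mem_kept hσs hσU)))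

/-! ### The old and the new subcomplex -/

/-- Sub-faces of old faces are old faces. [folklore] -/
theorem old_down : ∀ T ∈ S.oldFace '' X.U, ∀ T' ⊆ T, T'.Nonempty → T' ∈ S.oldFace '' X.U := by
  classical
  rintro _ ⟨σ, hσ, rfl⟩ T' hT' hne
  refine ⟨σ.filter fun v => oldV v ∈ T', X.u_down σ hσ _ (Finset.filter_subset _ _) ?_, ?_⟩
  · obtain ⟨y, hy⟩ := hne
    obtain ⟨v, hv, rfl⟩ := S.mem_oldFace.1 (hT' hy)
    exact ⟨v, Finset.mem_filter.2 ⟨hv, hy⟩⟩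
  · ext y
    simp only [BendSetup.oldFace, Finset.mem_image, Finset.mem_filter]
    constructor
    · rintro ⟨v, ⟨-, hvT⟩, rfl⟩; exact hvT
    · intro hy
      obtain ⟨v, hv, rfl⟩ := S.mem_oldFace.1 (hT' hy)
      exact ⟨v, ⟨hv, hy⟩, rfl⟩

/-- Sub-faces of new faces are new faces. [folklore] -/
theorem new_down : ∀ T ∈ S.newFace '' X.H.faces, ∀ T' ⊆ T, T'.Nonempty → T' ∈ S.newFace '' X.H.faces := by
  classical
  rintro _ ⟨ρ, hρ, rfl⟩ T' hT' hne
  refine ⟨ρ.filter fun p => S.psi p ∈ T', X.H.down_closed hρ (Finset.filter_subset _ _) ?_, ?_⟩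
  · obtain ⟨y, hy⟩ := hne
    obtain ⟨p, hp, rfl⟩ := S.mem_newFace.1 (hT' hy)
    exact ⟨p, Finset.mem_filter.2 ⟨hp, hy⟩⟩
  · ext y
    simp only [BendSetup.newFace, Finset.mem_image, Finset.mem_filter]
    constructor
    · rintro ⟨p, ⟨-, hpT⟩, rfl⟩; exact hpT
    · intro hy
      obtain ⟨p, hp, rfl⟩ := S.mem_newFace.1 (hT' hy)
      exact ⟨p, ⟨hp, hy⟩, rfl⟩

/-- The old subcomplex of `G₃`. [folklore] -/
def Gold : Geometry.SimplicialComplex ℝ (V₃ n N) :=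
  subcomplexOf X.G₃ (S.oldFace '' X.U) (fun _ h => Or.inl h) X.old_down

/-- The new subcomplex of `G₃`. [folklore] -/
def Gnew : Geometry.SimplicialComplex ℝ (V₃ n N) :=
  subcomplexOf X.G₃ (S.newFace '' X.H.faces) (fun _ h => Or.inr h) X.new_down

/-- Auxiliary (`mem_Gold_faces`). [folklore] -/
theorem mem_Gold_faces {T : Finset (V₃ n N)} : T ∈ X.Gold.faces ↔ ∃ σ ∈ X.U, S.oldFace σ = T := Iff.rfl

/-- Auxiliary (`mem_Gnew_faces`). [folklore] -/
theorem mem_Gnew_faces {T : Finset (V₃ n N)} : T ∈ X.Gnew.faces ↔ ∃ ρ ∈ X.H.faces, S.newFace ρ = T := Iff.rfl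

/-- Auxiliary (`gnew_finite`). [folklore] -/
theorem gnew_finite : X.Gnew.faces.Finite := X.G₃_finite.subset fun _ h => Or.inr h

/-- Auxiliary (`gold_finite`). [folklore] -/
theorem gold_finite : X.Gold.faces.Finite := X.G₃_finite.subset fun _ h => Or.inl h

/-- `G₃.space = Gold.space ∪ Gnew.space`. [folklore] -/
theorem G₃_space : X.G₃.space = X.Gold.space ∪ X.Gnew.space := by
  ext x
  simp only [Geometry.SimplicialComplex.mem_space_iff, mem_union]
  constructor
  · rintro ⟨T, hT | hT, hx⟩
    · exact Or.inl ⟨T, hT, hx⟩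
    · exact Or.inr ⟨T, hT, hx⟩
  · rintro (⟨T, hT, hx⟩ | ⟨T, hT, hx⟩)
    · exact ⟨T, Or.inl hT, hx⟩
    · exact ⟨T, Or.inr hT, hx⟩

/-- Points of the old part are lifts of points of unchanged simplices. [folklore] -/
theorem exists_of_mem_Gold_space {x : V₃ n N} (hx : x ∈ X.Gold.space) :
    ∃ σ ∈ X.U, ∃ w ∈ convexHull ℝ (σ : Set (Fin N → ℝ)), oldV w = x := by
  obtain ⟨_, ⟨σ, hσ, rfl⟩, hxT⟩ := Geometry.SimplicialComplex.mem_space_iff.1 hx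
  obtain ⟨w, hw, rfl⟩ := S.mem_convexHull_oldFace_iff.1 hxT
  exact ⟨σ, hσ, w, hw, rfl⟩

/-! ### The chart map `hmap` on the new part -/

/-- **The chart map** of the new part: the simplexwise affine interpolation of `gval`. [folklore] -/
def hmap : V₃ n N → 𝔼 n := plMap X.Gnew S.gval

/-- **`hmap` on a combination of translated vertices.** [folklore] -/
theorem hmap_rep {ρ : Finset (𝔼 n)} (hρ : ρ ∈ X.H.faces) {c : 𝔼 n → ℝ} (hc0 : ∀ p ∈ ρ, 0 ≤ c p)
    (hc1 : ∑ p ∈ ρ, c p = 1) : X.hmap (∑ p ∈ ρ, c p • S.psi p) = ∑ p ∈ ρ, c p • p := by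
  classical
  have hT : S.newFace ρ ∈ X.Gnew.faces := ⟨ρ, hρ, rfl⟩
  -- re-index over the translated vertices
  set w : V₃ n N → ℝ := fun y => c (Function.invFun S.psi y) with hw
  have hinv : ∀ p, Function.invFun S.psi (S.psi p) = p := Function.leftInverse_invFun S.psi_injective
  have hinj : ∀ p ∈ ρ, ∀ q ∈ ρ, S.psi p = S.psi q → p = q := fun p _ q _ h => S.psi_injective h
  have e1 : ∑ y ∈ S.newFace ρ, w y • y = ∑ p ∈ ρ, c p • S.psi p := by
    unfold BendSetup.newFace; rw [Finset.sum_image hinj]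
    exact Finset.sum_congr rfl fun p _ => by rw [hw]; simp only [hinv]
  have e2 : ∑ y ∈ S.newFace ρ, w y = 1 := by
    unfold BendSetup.newFace; rw [Finset.sum_image hinj, ← hc1]
    exact Finset.sum_congr rfl fun p _ => by rw [hw]; simp only [hinv]
  have e3 : ∑ y ∈ S.newFace ρ, w y • S.gval y = ∑ p ∈ ρ, c p • p := by
    unfold BendSetup.newFace; rw [Finset.sum_image hinj]
    exact Finset.sum_congr rfl fun p _ => by rw [hw]; simp only [hinv, S.gval_psi]
  have hx : ∑ p ∈ ρ, c p • S.psi p ∈ convexHull ℝ ((S.newFace ρ : Finset (V₃ n N)) : Set (V₃ n N)) :=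
    S.sum_mem_convexHull_newFace hc0 hc1
  rw [hmap, plMap_eqOn_interp hT hx, ← e1,
    affineMap_apply_sum_smul (g := S.gval) (fun y hy => interp_apply_of_mem _ _ hy) e2, e3]

/-- `hmap` maps a closed new face onto the closed chart simplex. [folklore] -/
theorem hmap_mem {ρ : Finset (𝔼 n)} (hρ : ρ ∈ X.H.faces) {x : V₃ n N}
    (hx : x ∈ convexHull ℝ ((S.newFace ρ : Finset (V₃ n N)) : Set (V₃ n N))) :
    X.hmap x ∈ convexHull ℝ (ρ : Set (𝔼 n)) := by
  obtain ⟨c, hc0, hc1, rfl⟩ := S.exists_rep_of_mem_convexHull_newFace hx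
  rw [X.hmap_rep hρ hc0 hc1]
  exact (convex_convexHull ℝ _).sum_mem hc0 hc1 fun p hp => subset_convexHull ℝ _ hp

/-- Every point of a closed chart simplex of `H` is attained by `hmap` on the translated face.
[folklore] -/
theorem exists_hmap_eq {ρ : Finset (𝔼 n)} (hρ : ρ ∈ X.H.faces) {h : 𝔼 n} (hh : h ∈ convexHull ℝ (ρ : Set (𝔼 n))) :
    ∃ x ∈ convexHull ℝ ((S.newFace ρ : Finset (V₃ n N)) : Set (V₃ n N)), X.hmap x = h := by
  classical
  obtain ⟨c, hc0, hc1, rfl⟩ := Finset.mem_convexHull'.1 hh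
  exact ⟨∑ p ∈ ρ, c p • S.psi p, S.sum_mem_convexHull_newFace hc0 hc1, X.hmap_rep hρ hc0 hc1⟩

/-- **Support of a representation**: if the chart value of a combination over `ρ₁` lies in the
closed simplex of `ρ₂`, the combination lies in the closed translated face of `ρ₁ ∩ ρ₂`. [folklore] -/
theorem rep_mem_inter {ρ₁ ρ₂ : Finset (𝔼 n)} (h₁ : ρ₁ ∈ X.H.faces) (h₂ : ρ₂ ∈ X.H.faces)
    {c : 𝔼 n → ℝ} (hc0 : ∀ p ∈ ρ₁, 0 ≤ c p) (hc1 : ∑ p ∈ ρ₁, c p = 1)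
    (hmem₂ : ∑ p ∈ ρ₁, c p • p ∈ convexHull ℝ (ρ₂ : Set (𝔼 n))) :
    ∑ p ∈ ρ₁, c p • S.psi p ∈ convexHull ℝ ((S.newFace (ρ₁ ∩ ρ₂) : Finset (V₃ n N)) : Set (V₃ n N)) := by
  classical
  have hmem₁ : ∑ p ∈ ρ₁, c p • p ∈ convexHull ℝ (ρ₁ : Set (𝔼 n)) :=
    (convex_convexHull ℝ _).sum_mem hc0 hc1 fun p hp => subset_convexHull ℝ _ hp
  have hmem : ∑ p ∈ ρ₁, c p • p ∈ convexHull ℝ (↑(ρ₁ ∩ ρ₂) : Set (𝔼 n)) := by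
    rw [Finset.coe_inter]; exact X.H.inter_subset_convexHull h₁ h₂ ⟨hmem₁, hmem₂⟩
  obtain ⟨e, he0, he1, hex⟩ := Finset.mem_convexHull'.1 hmem
  set e' : 𝔼 n → ℝ := fun p => if p ∈ ρ₂ then e p else 0 with he'
  have hsplit : ∀ g : 𝔼 n → ℝ, (∀ p ∈ ρ₁, p ∉ ρ₂ → g p = 0) → ∑ p ∈ ρ₁, g p = ∑ p ∈ ρ₁ ∩ ρ₂, g p := fun g hg => by
    rw [← Finset.sum_filter_add_sum_filter_not ρ₁ (fun p => p ∈ ρ₂), Finset.filter_mem_eq_inter,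
      Finset.sum_eq_zero fun p hp => hg p (Finset.mem_filter.1 hp).1 (Finset.mem_filter.1 hp).2, add_zero]
  have hsplitV : ∀ g : 𝔼 n → 𝔼 n, (∀ p ∈ ρ₁, p ∉ ρ₂ → g p = 0) → ∑ p ∈ ρ₁, g p = ∑ p ∈ ρ₁ ∩ ρ₂, g p := fun g hg => by
    rw [← Finset.sum_filter_add_sum_filter_not ρ₁ (fun p => p ∈ ρ₂), Finset.filter_mem_eq_inter,
      Finset.sum_eq_zero fun p hp => hg p (Finset.mem_filter.1 hp).1 (Finset.mem_filter.1 hp).2, add_zero]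
  have hsplitW : ∀ g : 𝔼 n → V₃ n N, (∀ p ∈ ρ₁, p ∉ ρ₂ → g p = 0) → ∑ p ∈ ρ₁, g p = ∑ p ∈ ρ₁ ∩ ρ₂, g p := fun g hg => by
    rw [← Finset.sum_filter_add_sum_filter_not ρ₁ (fun p => p ∈ ρ₂), Finset.filter_mem_eq_inter,
      Finset.sum_eq_zero fun p hp => hg p (Finset.mem_filter.1 hp).1 (Finset.mem_filter.1 hp).2, add_zero]
  have he'1 : ∑ p ∈ ρ₁, e' p = 1 := by
    rw [hsplit e' (fun p _ hp => by simp [he', hp]), ← he1]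
    exact Finset.sum_congr rfl fun p hp => by simp [he', (Finset.mem_inter.1 hp).2]
  have he'x : ∑ p ∈ ρ₁, e' p • p = ∑ p ∈ ρ₁, c p • p := by
    rw [hsplitV (fun p => e' p • p) (fun p _ hp => by simp [he', hp]), ← hex]
    exact Finset.sum_congr rfl fun p hp => by simp [he', (Finset.mem_inter.1 hp).2]
  have hce : ∀ p ∈ ρ₁, c p = e' p :=
    (X.H.indep h₁).eq_of_sum_eq_sum_subtype (by rw [hc1, he'1]) he'x.symm
  have hc0' : ∀ p ∈ ρ₁, p ∉ ρ₂ → c p = 0 := fun p hp hp2 => by rw [hce p hp]; simp [he', hp2]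
  rw [hsplitW (fun p => c p • S.psi p) (fun p hp hp2 => by rw [hc0' p hp hp2, zero_smul])]
  refine S.sum_mem_convexHull_newFace (fun p hp => hc0 p (Finset.mem_inter.1 hp).1) ?_
  rw [← hsplit c hc0', hc1]

/-- **`hmap` is injective on a closed new face** (uniqueness of barycentric coordinates).
[folklore] -/
theorem injOn_hmap_face {ρ : Finset (𝔼 n)} (hρ : ρ ∈ X.H.faces) :
    InjOn X.hmap (convexHull ℝ ((S.newFace ρ : Finset (V₃ n N)) : Set (V₃ n N))) := by
  classical
  intro x hx x' hx' hxx
  obtain ⟨c, hc0, hc1, rfl⟩ := S.exists_rep_of_mem_convexHull_newFace hx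
  obtain ⟨c', hc0', hc1', rfl⟩ := S.exists_rep_of_mem_convexHull_newFace hx'
  rw [X.hmap_rep hρ hc0 hc1, X.hmap_rep hρ hc0' hc1'] at hxx
  have hcc : ∀ p ∈ ρ, c p = c' p := (X.H.indep hρ).eq_of_sum_eq_sum_subtype (by rw [hc1, hc1']) hxx
  exact Finset.sum_congr rfl fun p hp => by rw [hcc p hp]

/-- **`hmap` is injective on the new part.** [folklore] -/
theorem injOn_hmap : InjOn X.hmap X.Gnew.space := by
  classical
  intro x hx x' hx' hxx
  obtain ⟨_, ⟨ρ₁, hρ₁, rfl⟩, hx₁⟩ := Geometry.SimplicialComplex.mem_space_iff.1 hx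
  obtain ⟨_, ⟨ρ₂, hρ₂, rfl⟩, hx₂⟩ := Geometry.SimplicialComplex.mem_space_iff.1 hx'
  -- `x` lies in the translated face of `ρ₁ ∩ ρ₂ ⊆ ρ₂`
  obtain ⟨c, hc0, hc1, rfl⟩ := S.exists_rep_of_mem_convexHull_newFace hx₁
  have hval : ∑ p ∈ ρ₁, c p • p ∈ convexHull ℝ (ρ₂ : Set (𝔼 n)) := by
    rw [← X.hmap_rep hρ₁ hc0 hc1, hxx]; exact X.hmap_mem hρ₂ hx₂
  have hmem := X.rep_mem_inter hρ₁ hρ₂ hc0 hc1 hval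
  have hsub : convexHull ℝ ((S.newFace (ρ₁ ∩ ρ₂) : Finset (V₃ n N)) : Set (V₃ n N)) ⊆
      convexHull ℝ ((S.newFace ρ₂ : Finset (V₃ n N)) : Set (V₃ n N)) := by
    refine convexHull_mono ?_
    rw [S.newFace_inter]; exact_mod_cast Finset.inter_subset_right
  exact X.injOn_hmap_face hρ₂ (hsub hmem) hx₂ hxx

/-- `hmap` is continuous on the new part. [folklore] -/
theorem continuousOn_hmap : ContinuousOn X.hmap X.Gnew.space := continuousOn_plMap X.gnew_finite S.gval

/-- The image of the new part under `hmap` is `H.space`. [folklore] -/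
theorem hmap_image : X.hmap '' X.Gnew.space = X.H.space := by
  refine Subset.antisymm ?_ ?_
  · rintro _ ⟨x, hx, rfl⟩
    obtain ⟨_, ⟨ρ, hρ, rfl⟩, hxT⟩ := Geometry.SimplicialComplex.mem_space_iff.1 hx
    exact X.H.convexHull_subset_space hρ (X.hmap_mem hρ hxT)
  · intro h hh
    obtain ⟨ρ, hρ, hhρ⟩ := Geometry.SimplicialComplex.mem_space_iff.1 hh
    obtain ⟨x, hx, rfl⟩ := X.exists_hmap_eq hρ hhρ
    exact ⟨x, X.Gnew.convexHull_subset_space ⟨ρ, hρ, rfl⟩ hx, rfl⟩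

/-- `H.space` lies in the chart target. [folklore] -/
theorem H_space_subset_target : X.H.space ⊆ I.e.target := by
  rw [X.H_space, Q_space_eq (S := S)]
  rintro y (⟨x, hx, rfl⟩ | hy)
  · obtain ⟨hsrc, he⟩ := S.e_fbend_eq_Λ hx
    rw [← he]; exact I.e.map_source hsrc
  · exact I.R₁t (X.RP_subset_R₁ (X.R₀_subset_RP hy))

/-! ### The extended map -/

open Classical in
/-- **The extended map** `F₃`: the bent map of the first coordinate on the old part, `e.symm ∘ hmap`
elsewhere. [folklore] -/
def F₃ : V₃ n N → M := fun x => if x ∈ X.Gold.space then S.fbend x.1 else I.e.symm (X.hmap x)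

/-- Auxiliary (`F₃_of_mem_Gold`). [folklore] -/
theorem F₃_of_mem_Gold {x : V₃ n N} (hx : x ∈ X.Gold.space) : X.F₃ x = S.fbend x.1 := by
  simp [F₃, hx]

/-- Auxiliary (`F₃_of_notMem_Gold`). [folklore] -/
theorem F₃_of_notMem_Gold {x : V₃ n N} (hx : x ∉ X.Gold.space) : X.F₃ x = I.e.symm (X.hmap x) := by
  simp [F₃, hx]

/-- **Consistency on the overlap**: a point of both parts is the lift of a point `w` of a straight
simplex, and there `f' w = e.symm (hmap x)`. [folklore] -/
theorem F₃_eq_of_mem_Gnew {x : V₃ n N} (hx : x ∈ X.Gnew.space) : X.F₃ x = I.e.symm (X.hmap x) := by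
  classical
  by_cases hxo : x ∈ X.Gold.space
  · rw [X.F₃_of_mem_Gold hxo]
    obtain ⟨_, ⟨σ, hσ, rfl⟩, hxσ⟩ := Geometry.SimplicialComplex.mem_space_iff.1 hxo
    obtain ⟨_, ⟨ρ, hρ, rfl⟩, hxρ⟩ := Geometry.SimplicialComplex.mem_space_iff.1 hx
    -- as in `inter_old_new`: `x = oldV w` with `w ∈ conv (σ ∩ sv ρ)`
    obtain ⟨w, hw, rfl⟩ := S.mem_convexHull_oldFace_iff.1 hxσ
    obtain ⟨c, hc0, hc1, hcx⟩ := S.exists_rep_of_mem_convexHull_newFace hxρ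
    obtain ⟨h1, -, h3⟩ := S.components_sum ρ c
    rw [hcx] at h1 h3
    simp only [oldV_fst, oldV_snd_snd] at h1 h3
    have hcv0 : ∀ v ∈ S.sv ρ, 0 ≤ c (S.Λ v) := fun v hv => hc0 _ (S.mem_sv.1 hv).2
    have hne : (S.sv ρ).Nonempty := by
      by_contra h; rw [Finset.not_nonempty_iff_eq_empty] at h
      rw [h, Finset.sum_empty] at h3; exact one_ne_zero h3
    have hsvstr : S.sv ρ ∈ S.Str := X.sv_str hρ hne
    have hwsv : w ∈ convexHull ℝ ((S.sv ρ : Finset (Fin N → ℝ)) : Set (Fin N → ℝ)) := by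
      rw [h1]; exact (convex_convexHull ℝ _).sum_mem hcv0 h3.symm fun v hv => subset_convexHull ℝ _ hv
    -- `f' w = e.symm (Λ w)` and `Λ w = hmap x`
    obtain ⟨hsrc, he, hΛ⟩ := S.straight hsvstr.1.1 hsvstr.2 hwsv
    have hΛw : S.Λ w = ∑ v ∈ S.sv ρ, c (S.Λ v) • S.Λ v := by
      rw [S.Λ_eqOn hsvstr.1.1 hwsv, h1]
      exact affineMap_apply_sum_smul (A := S.A _ hsvstr.1.1) (g := S.Λ)
        (fun v hv => (S.Λ_eqOn hsvstr.1.1 (subset_convexHull ℝ _ hv)).symm) h3.symm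
    have hhm : X.hmap (oldV w) = ∑ p ∈ ρ, c p • p := by rw [← hcx]; exact X.hmap_rep hρ hc0 hc1
    -- the new coefficients vanish: compare the sums via `sum_split`
    have hnw0 : ∀ p ∈ S.nw ρ, c p = 0 := by
      have hs := S.sum_split ρ c
      rw [hc1, ← h3] at hs
      have h0 : ∑ p ∈ S.nw ρ, c p = 0 := by linarith
      exact (Finset.sum_eq_zero_iff_of_nonneg fun p hp => hc0 p (S.mem_nw.1 hp).1).1 h0
    have hval : ∑ p ∈ ρ, c p • p = ∑ v ∈ S.sv ρ, c (S.Λ v) • S.Λ v := by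
      have hz : ∑ p ∈ S.nw ρ, c p • p = 0 := Finset.sum_eq_zero fun p hp => by rw [hnw0 p hp, zero_smul]
      rw [S.sum_split ρ (fun p => c p • p), hz, add_zero]
    show S.fbend w = I.e.symm (X.hmap (oldV w))
    rw [hhm, hval, ← hΛw, hΛ, ← he, I.e.left_inv hsrc]
  · exact X.F₃_of_notMem_Gold hxo

/-! ### Injectivity of the extended map -/

/-- On the new part `F₃` lands in the chart source with `e ∘ F₃ = hmap`. [folklore] -/
theorem F₃_mem_source_of_mem_Gnew {x : V₃ n N} (hx : x ∈ X.Gnew.space) :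
    X.F₃ x ∈ I.e.source ∧ I.e (X.F₃ x) = X.hmap x := by
  have ht : X.hmap x ∈ I.e.target := X.H_space_subset_target (by rw [← X.hmap_image]; exact ⟨x, hx, rfl⟩)
  rw [X.F₃_eq_of_mem_Gnew hx]
  exact ⟨I.e.map_target ht, I.e.right_inv ht⟩

/-- Points of the old part. [folklore] -/
theorem oldV_fst_of_mem_Gold {x : V₃ n N} (hx : x ∈ X.Gold.space) : oldV x.1 = x ∧ x.1 ∈ S.Kb.space := by
  obtain ⟨σ, hσ, w, hw, rfl⟩ := X.exists_of_mem_Gold_space hx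
  exact ⟨rfl, S.Kb.convexHull_subset_space hσ.1 hw⟩

/-- **A lift of a straight point of an unchanged simplex lies in the new part.** [folklore] -/
theorem oldV_mem_Gnew_space {σ : Finset (Fin N → ℝ)} (hσ : σ ∈ X.U) {w : Fin N → ℝ}
    (hw : w ∈ convexHull ℝ (σ : Set (Fin N → ℝ))) (hws : w ∈ S.StrCx.space) : oldV w ∈ X.Gnew.space := by
  classical
  obtain ⟨t, ht, hwt⟩ := Geometry.SimplicialComplex.mem_space_iff.1 hws
  have hw0 : w ∈ convexHull ℝ (↑(σ ∩ t) : Set (Fin N → ℝ)) := by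
    rw [Finset.coe_inter]; exact S.Kb.inter_subset_convexHull hσ.1 ht.1 ⟨hw, hwt⟩
  have hne : (σ ∩ t).Nonempty := by
    by_contra h
    rw [Finset.not_nonempty_iff_eq_empty] at h
    rw [h, Finset.coe_empty, convexHull_empty] at hw0
    exact hw0
  have hstr : σ ∩ t ∈ S.Str := S.str_down t ht _ Finset.inter_subset_right hne
  have hU : σ ∩ t ∈ X.U := X.u_down σ hσ _ Finset.inter_subset_left hne
  have hH : S.rIm (σ ∩ t) ∈ X.H.faces := X.rIm_mem_H hstr hU
  refine X.Gnew.convexHull_subset_space ⟨S.rIm (σ ∩ t), hH, S.newFace_rIm hstr⟩ ?_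
  exact S.mem_convexHull_oldFace_iff.2 ⟨w, hw0, rfl⟩

/-- **Reduction of the mixed case**: if a point of the old part and a point of the new part have
the same image, the former lies in the new part as well. [folklore] -/
theorem mem_Gnew_of_F₃_eq {x x' : V₃ n N} (hx : x ∈ X.Gold.space) (hx' : x' ∈ X.Gnew.space)
    (h : X.F₃ x = X.F₃ x') : x ∈ X.Gnew.space := by
  obtain ⟨σ, hσ, w, hw, rfl⟩ := X.exists_of_mem_Gold_space hx
  have hwK : w ∈ S.Kb.space := S.Kb.convexHull_subset_space hσ.1 hw
  rw [X.F₃_of_mem_Gold hx] at h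
  simp only [oldV_fst] at h
  obtain ⟨hsrc', he'⟩ := X.F₃_mem_source_of_mem_Gnew hx'
  have hsrc : S.fbend w ∈ I.e.source := by rw [h]; exact hsrc'
  have hval : I.e (S.fbend w) ∈ X.H.space := by
    rw [h, he', ← X.hmap_image]; exact ⟨x', hx', rfl⟩
  -- `w` lies in the straight part
  have hws : w ∈ S.StrCx.space := by
    rw [X.H_space, Q_space_eq (S := S)] at hval
    rcases hval with ⟨y, hy, hye⟩ | hR
    · obtain ⟨hysrc, hey⟩ := S.e_fbend_eq_Λ hy
      have : w = y := S.injOn_fbend hwK (S.strCx_space_subset hy) (I.e.injOn hsrc hysrc (by rw [hey, hye]))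
      rwa [this]
    · have hz : w ∈ zone I.K I.f I.e I.R₁ :=
        X.mem_zone₁_of_fbend hwK hsrc (self_subset_cthickening _ (X.R₀_subset_RP hR))
      exact S.StrCx.convexHull_subset_space (S.str_of_meets₁ hσ.1 ⟨w, hw, hz⟩) hw
  exact X.oldV_mem_Gnew_space hσ hw hws

/-- **The extended map is injective on the glued complex.** [folklore] -/
theorem injOn_F₃ : InjOn X.F₃ X.G₃.space := by
  -- the new/new case
  have hnn : ∀ {x x' : V₃ n N}, x ∈ X.Gnew.space → x' ∈ X.Gnew.space → X.F₃ x = X.F₃ x' → x = x' :=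
    fun {x x'} hx hx' h => by
    obtain ⟨hs, he⟩ := X.F₃_mem_source_of_mem_Gnew hx
    obtain ⟨hs', he'⟩ := X.F₃_mem_source_of_mem_Gnew hx'
    exact X.injOn_hmap hx hx' (by rw [← he, ← he', h])
  intro x hx x' hx' h
  rw [X.G₃_space] at hx hx'
  by_cases h1 : x ∈ X.Gnew.space <;> by_cases h2 : x' ∈ X.Gnew.space
  · exact hnn h1 h2 h
  · have hx'o : x' ∈ X.Gold.space := hx'.resolve_right h2
    exact hnn h1 (X.mem_Gnew_of_F₃_eq hx'o h1 h.symm) h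
  · have hxo : x ∈ X.Gold.space := hx.resolve_right h1
    exact hnn (X.mem_Gnew_of_F₃_eq hxo h2 h) h2 h
  · have hxo : x ∈ X.Gold.space := hx.resolve_right h1
    have hx'o : x' ∈ X.Gold.space := hx'.resolve_right h2
    obtain ⟨hxe, hxK⟩ := X.oldV_fst_of_mem_Gold hxo
    obtain ⟨hxe', hxK'⟩ := X.oldV_fst_of_mem_Gold hx'o
    rw [X.F₃_of_mem_Gold hxo, X.F₃_of_mem_Gold hx'o] at h
    rw [← hxe, ← hxe', S.injOn_fbend hxK hxK' h]

/-! ### Continuity, image and chart descriptions -/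

/-- **`F₃` is continuous on every closed face of `G₃`.** [folklore] -/
theorem continuousOn_F₃ {T : Finset (V₃ n N)} (hT : T ∈ X.G₃.faces) :
    ContinuousOn X.F₃ (convexHull ℝ (T : Set (V₃ n N))) := by
  rcases hT with ⟨σ, hσ, rfl⟩ | ⟨ρ, hρ, rfl⟩
  · have hsub : convexHull ℝ ((S.oldFace σ : Finset (V₃ n N)) : Set (V₃ n N)) ⊆ X.Gold.space :=
      X.Gold.convexHull_subset_space ⟨σ, hσ, rfl⟩
    have heq : EqOn X.F₃ (fun x => S.fbend x.1) (convexHull ℝ ((S.oldFace σ : Finset (V₃ n N)) : Set (V₃ n N))) :=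
      fun x hx => X.F₃_of_mem_Gold (hsub hx)
    refine ContinuousOn.congr ?_ heq
    refine (S.continuousOn_fbend hσ.1.1).comp continuous_fst.continuousOn fun x hx => ?_
    obtain ⟨w, hw, rfl⟩ := S.mem_convexHull_oldFace_iff.1 hx
    exact hw
  · have hsub : convexHull ℝ ((S.newFace ρ : Finset (V₃ n N)) : Set (V₃ n N)) ⊆ X.Gnew.space :=
      X.Gnew.convexHull_subset_space ⟨ρ, hρ, rfl⟩
    have heq : EqOn X.F₃ (fun x => I.e.symm (X.hmap x)) (convexHull ℝ ((S.newFace ρ : Finset (V₃ n N)) : Set (V₃ n N))) :=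
      fun x hx => X.F₃_eq_of_mem_Gnew (hsub hx)
    refine ContinuousOn.congr ?_ heq
    refine I.e.continuousOn_symm.comp (X.continuousOn_hmap.mono hsub) fun x hx => ?_
    exact X.H_space_subset_target (by rw [← X.hmap_image]; exact ⟨x, hsub hx, rfl⟩)

/-- Every simplex of `K''` is unchanged or straight. [folklore] -/
theorem mem_U_or_str {σ : Finset (Fin N → ℝ)} (hσ : σ ∈ S.Kb.faces) : σ ∈ X.U ∨ σ ∈ S.Str := by
  by_cases h : σ ∈ S.Str
  · exact Or.inr h
  · exact Or.inl (X.mem_U_of_not_str hσ h)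

/-- **The image of the extended map**: `F₃ '' G₃.space = f' '' K''.space ∪ e.symm '' R₀`. [folklore] -/
theorem F₃_image : X.F₃ '' X.G₃.space = S.fbend '' S.Kb.space ∪ I.e.symm '' X.R₀ := by
  refine Subset.antisymm ?_ ?_
  · rintro _ ⟨x, hx, rfl⟩
    by_cases hxn : x ∈ X.Gnew.space
    · rw [X.F₃_eq_of_mem_Gnew hxn]
      have hval : X.hmap x ∈ X.H.space := by rw [← X.hmap_image]; exact ⟨x, hxn, rfl⟩
      rw [X.H_space, Q_space_eq (S := S)] at hval
      rcases hval with ⟨y, hy, hye⟩ | hR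
      · left
        obtain ⟨hysrc, hey⟩ := S.e_fbend_eq_Λ hy
        refine ⟨y, S.strCx_space_subset hy, ?_⟩
        rw [← hye, ← hey, I.e.left_inv hysrc]
      · exact Or.inr ⟨X.hmap x, hR, rfl⟩
    · rw [X.G₃_space] at hx
      have hxo : x ∈ X.Gold.space := hx.resolve_right hxn
      rw [X.F₃_of_mem_Gold hxo]
      exact Or.inl ⟨x.1, (X.oldV_fst_of_mem_Gold hxo).2, rfl⟩
  · -- every value is attained
    have hnew : ∀ h ∈ X.H.space, I.e.symm h ∈ X.F₃ '' X.G₃.space := fun h hh => by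
      rw [← X.hmap_image] at hh
      obtain ⟨x, hx, rfl⟩ := hh
      refine ⟨x, by rw [X.G₃_space]; exact Or.inr hx, X.F₃_eq_of_mem_Gnew hx⟩
    rintro q (⟨w, hwK, rfl⟩ | ⟨z, hz, rfl⟩)
    · obtain ⟨σ, hσ, hwσ⟩ := Geometry.SimplicialComplex.mem_space_iff.1 hwK
      rcases X.mem_U_or_str hσ with hU | hstr
      · have hxo : oldV w ∈ X.Gold.space :=
          X.Gold.convexHull_subset_space ⟨σ, hU, rfl⟩ (S.mem_convexHull_oldFace_iff.2 ⟨w, hwσ, rfl⟩)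
        exact ⟨oldV w, by rw [X.G₃_space]; exact Or.inl hxo, by rw [X.F₃_of_mem_Gold hxo]; rfl⟩
      · have hws : w ∈ S.StrCx.space := S.StrCx.convexHull_subset_space hstr hwσ
        obtain ⟨hsrc, he⟩ := S.e_fbend_eq_Λ hws
        have hΛ : S.Λ w ∈ X.H.space := by
          rw [X.H_space, Q_space_eq (S := S)]; exact Or.inl ⟨w, hws, rfl⟩
        have := hnew _ hΛ
        rwa [← he, I.e.left_inv hsrc] at this
    · exact hnew z (X.R₀_subset_H hz)

/-- **Old faces**: `F₃ = f' ∘ fst`, and the first projection maps the closed face onto the closed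
simplex. [folklore] -/
theorem old_face_desc {σ : Finset (Fin N → ℝ)} (hσ : σ ∈ X.U) :
    EqOn X.F₃ (fun x => S.fbend x.1) (convexHull ℝ ((S.oldFace σ : Finset (V₃ n N)) : Set (V₃ n N))) ∧
    Prod.fst '' convexHull ℝ ((S.oldFace σ : Finset (V₃ n N)) : Set (V₃ n N)) = convexHull ℝ (σ : Set (Fin N → ℝ)) := by
  refine ⟨fun x hx => X.F₃_of_mem_Gold (X.Gold.convexHull_subset_space ⟨σ, hσ, rfl⟩ hx), ?_⟩
  rw [S.convexHull_oldFace, Set.image_image]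
  simp

/-- **New faces**: an affine chart model `A` of `hmap` on the closed face, `F₃ = e.symm ∘ A` there,
`e ∘ F₃ = A`, and `A` maps the closed face onto the closed chart simplex. [folklore] -/
theorem new_face_desc {ρ : Finset (𝔼 n)} (hρ : ρ ∈ X.H.faces) :
    ∃ A : V₃ n N →ᵃ[ℝ] 𝔼 n, EqOn X.hmap A (convexHull ℝ ((S.newFace ρ : Finset (V₃ n N)) : Set (V₃ n N))) ∧
      (∀ x ∈ convexHull ℝ ((S.newFace ρ : Finset (V₃ n N)) : Set (V₃ n N)), X.F₃ x ∈ I.e.source ∧ I.e (X.F₃ x) = A x) ∧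
      A '' convexHull ℝ ((S.newFace ρ : Finset (V₃ n N)) : Set (V₃ n N)) = convexHull ℝ (ρ : Set (𝔼 n)) := by
  have hT : S.newFace ρ ∈ X.Gnew.faces := ⟨ρ, hρ, rfl⟩
  have hsub : convexHull ℝ ((S.newFace ρ : Finset (V₃ n N)) : Set (V₃ n N)) ⊆ X.Gnew.space :=
    X.Gnew.convexHull_subset_space hT
  refine ⟨interp (S.newFace ρ) (X.Gnew.indep hT) S.gval, plMap_eqOn_interp hT, fun x hx => ?_, ?_⟩
  · rw [← plMap_eqOn_interp (K := X.Gnew) (g := S.gval) hT hx]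
    exact X.F₃_mem_source_of_mem_Gnew (hsub hx)
  · refine Subset.antisymm ?_ ?_
    · rintro _ ⟨x, hx, rfl⟩
      rw [← plMap_eqOn_interp (K := X.Gnew) (g := S.gval) hT hx]
      exact X.hmap_mem hρ hx
    · intro h hh
      obtain ⟨x, hx, rfl⟩ := X.exists_hmap_eq hρ hh
      exact ⟨x, hx, (plMap_eqOn_interp (K := X.Gnew) (g := S.gval) hT hx).symm⟩

/-- **Where the new faces lie**: in the inner box, or in the image of a straight simplex. [folklore] -/
theorem new_face_inside {ρ : Finset (𝔼 n)} (hρ : ρ ∈ X.H.faces) :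
    convexHull ℝ (ρ : Set (𝔼 n)) ⊆ X.R₀ ∨
      ∃ u₀ ∈ S.Str, convexHull ℝ (ρ : Set (𝔼 n)) ⊆ S.Λ '' convexHull ℝ (u₀ : Set (Fin N → ℝ)) := by
  rcases X.mem_H_faces.1 hρ with hK | hB
  · right
    rcases X.K'_refines hK with ⟨s, ⟨t, ht, σ₀, hσ₀t, hne, rfl⟩, hsub⟩ | ⟨u, hu, -, hsub⟩
    · have hσ₀ : σ₀ ∈ S.Str := X.str_of_subset_T₁ ht hσ₀t hne
      rw [S.convexHull_rIm hσ₀] at hsub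
      exact ⟨σ₀, hσ₀, hsub⟩
    · obtain ⟨u₀, hu₀, rfl⟩ := S.mem_Q_faces.1 hu
      rw [S.Q_hull hu₀] at hsub
      exact ⟨u₀, hu₀, hsub⟩
  · exact Or.inl hB.2

/-- **Straightness for the new chart**: a closed face of `G₃` whose image meets
`e.symm '' (open outer box)` is mapped by `e ∘ F₃` affinely (inside the chart source). [folklore] -/
theorem straight_of_meets {T : Finset (V₃ n N)} (hT : T ∈ X.G₃.faces)
    (hmeet : (X.F₃ '' convexHull ℝ (T : Set (V₃ n N)) ∩ I.e.symm '' openBox X.aP X.bP).Nonempty) :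
    ∃ A : V₃ n N →ᵃ[ℝ] 𝔼 n, ∀ x ∈ convexHull ℝ (T : Set (V₃ n N)), X.F₃ x ∈ I.e.source ∧ I.e (X.F₃ x) = A x := by
  rcases hT with ⟨σ, hσ, rfl⟩ | ⟨ρ, hρ, rfl⟩
  · -- an unchanged simplex whose bent image meets the outer box is straight
    obtain ⟨_, ⟨x₀, hx₀, rfl⟩, z, hz, hzx⟩ := hmeet
    obtain ⟨w₀, hw₀, rfl⟩ := S.mem_convexHull_oldFace_iff.1 hx₀
    have hGold : ∀ {w}, w ∈ convexHull ℝ (σ : Set (Fin N → ℝ)) → oldV w ∈ X.Gold.space := fun {w} hw =>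
      X.Gold.convexHull_subset_space ⟨σ, hσ, rfl⟩ (S.mem_convexHull_oldFace_iff.2 ⟨w, hw, rfl⟩)
    rw [X.F₃_of_mem_Gold (hGold hw₀)] at hzx
    simp only [oldV_fst] at hzx
    have hzt : z ∈ I.e.target := I.R₁t (X.RP_subset_R₁ (openBox_subset_box _ _ hz))
    have hsrc : S.fbend w₀ ∈ I.e.source := by rw [← hzx]; exact I.e.map_target hzt
    have hw₀K : w₀ ∈ S.Kb.space := S.Kb.convexHull_subset_space hσ.1 hw₀
    have hzone : w₀ ∈ zone I.K I.f I.e I.R₁ := by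
      refine X.mem_zone₁_of_fbend hw₀K hsrc (self_subset_cthickening _ ?_)
      rw [← hzx, I.e.right_inv hzt]; exact openBox_subset_box _ _ hz
    have hstr : σ ∈ S.Str := S.str_of_meets₁ hσ.1 ⟨w₀, hw₀, hzone⟩
    refine ⟨(S.A σ hσ.1.1).comp (LinearMap.fst ℝ (Fin N → ℝ) (EuclideanSpace ℝ (Fin n) × ℝ)).toAffineMap, fun x hx => ?_⟩
    obtain ⟨w, hw, rfl⟩ := S.mem_convexHull_oldFace_iff.1 hx
    obtain ⟨hs, he, -⟩ := S.straight hσ.1.1 hstr.2 hw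
    rw [X.F₃_of_mem_Gold (hGold hw)]
    refine ⟨hs, ?_⟩
    show I.e (S.fbend w) = S.A σ hσ.1.1 (oldV (n := n) w).1
    exact he
  · obtain ⟨A, -, hA, -⟩ := X.new_face_desc hρ
    exact ⟨A, hA⟩

end ExtInput

end BendSetup

end BendInput

end Literature.Topology.FourManifolds
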